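import Mathlib
import HarnessLib

/-!
# Route `KLProgramme` — vocabulary of DECOMP C2 «ChannelRiccati»: bottoms of quadratic forms and the scalar
# one-loop Cooper-channel maps (cell gate-hubbard-kl, seat p3; crux K3 = `KLRegimeTwoPointLimit`, stmt-HubbardSuperconductivity-19937)

In the sign-resolved Cooper-channel flow of the Kohn–Luttinger programme (HOME/DECOMP.md §2 C2, App. B, App. E (E2, E.4))
each `D₄` block `V_h` of the Cooper vertex — a bounded self-adjoint operator on the complex Hilbert space
`L²(F_μ, ds/|∇ε|)` of the certificate — is updated scale by scale by the one-loop particle–particle step with bubble weight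
`b_h ≥ 0`, either in the polynomial (Riccati) form `V ↦ V - b V²` or in the exact single-scale ladder / CASCADE form
`V ↦ V (1 + b V)⁻¹`, plus a small self-adjoint remainder.  The comparison theorems (files
`KLProgrammeCooperChannelRiccatiFlow*.lean`) say that the BOTTOM of the block's quadratic form follows the corresponding
SCALAR map exactly and that a remainder `P` moves it by at most `‖P‖`.  This file only NAMES the objects — nothing is
proved here:

* `formInf T = inf {Re ⟪v, T v⟫ : ‖v‖ = 1}` — the bottom of the quadratic form of a bounded operator on the unit sphere
  (`= min σ(T)` for self-adjoint `T`; `sInf ∅ = 0` on the zero space), and `formSup T = - formInf (-T)` its top;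
* `riccatiStep b x = x - b x²` and `cascadeStep b x = x / (1 + b x)` — the scalar one-loop maps;
* `attractiveEnvelope A B = -A / (1 - A B)` and `repulsiveEnvelope A B = A / (1 + A B)` — the explicit solutions of the
  scalar cascade flow from `∓A` after accumulated bubble mass `B` (the two-sided envelopes of DECOMP C2(b):
  `λ_h ∈ -a_± U² / (1 - a_± U² Σ_{k>h} b_k)`);
The one-step comparison shape of record `C2OneStep E` (planner g2, DECOMP App. B) and its cascade analogue are NOT
re-declared as `Prop`s: they are PROVED, with verbatim statements, as `c2OneStep` / `c2OneStep_cascade` in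
`KLProgrammeCooperChannelRiccatiFlow.lean`.

References: planner files HOME/planner-g2/Sketch.lean (§C2), HOME/DECOMP.md v6 §2 C2, App. E; for the operator-theoretic
background (bottom of the numerical range of a self-adjoint operator, spectral mapping for monotone functions)
M. Reed, B. Simon, *Methods of Modern Mathematical Physics I*, Thm. VII.1 and IV, Thm. XIII.1.
-/

noncomputable section

namespace Summit.HubbardSuperconductivity.HubbardSuperconductivity.Theorems.CooperChannelRiccatiFlow

set_option linter.dupNamespace false -- summit = problem name (single-conjunct summit), D-0017

open scoped InnerProductSpace

variable {E : Type*} [NormedAddCommGroup E] [InnerProductSpace ℂ E]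

/-- **Bottom of the quadratic form** of a bounded operator `T` on the unit sphere:
`formInf T = inf {Re ⟪v, T v⟫ : ‖v‖ = 1}` (`= min σ(T)` for self-adjoint `T`; junk `sInf ∅ = 0` on the zero space). -/
def formInf (T : E →L[ℂ] E) : ℝ :=
  sInf ((fun v : E => RCLike.re ⟪v, T v⟫_ℂ) '' {v : E | ‖v‖ = 1})

/-- **Top of the quadratic form** of a bounded operator on the unit sphere, `formSup T = - formInf (-T)`
(`= sup {Re ⟪v, T v⟫ : ‖v‖ = 1} = max σ(T)` for self-adjoint `T` on a nonzero space). -/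
def formSup (T : E →L[ℂ] E) : ℝ := - formInf (-T)

/-- The scalar one-loop Cooper step in polynomial (Riccati) form, `x ↦ x - b x²`. -/
def riccatiStep (b x : ℝ) : ℝ := x - b * x ^ 2

/-- The scalar one-loop Cooper step in exact single-scale ladder (CASCADE, Möbius) form, `x ↦ x / (1 + b x)`;
for `x ≠ 0`, `1 + b x ≠ 0` it is the linear flow of the inverse coupling, `1 / cascadeStep b x = 1 / x + b`. -/
def cascadeStep (b x : ℝ) : ℝ := x / (1 + b * x)

/-- The attractive envelope `-A / (1 - A B)`: the scalar cascade flow started at `-A` after accumulated bubble mass `B`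
(onset at `A B = 1`). -/
def attractiveEnvelope (A B : ℝ) : ℝ := -A / (1 - A * B)

/-- The repulsive envelope `A / (1 + A B)`: the scalar cascade flow started at `A ≥ 0` after accumulated bubble mass `B`
(decays like `1 / B`). -/
def repulsiveEnvelope (A B : ℝ) : ℝ := A / (1 + A * B)

end Summit.HubbardSuperconductivity.HubbardSuperconductivity.Theorems.CooperChannelRiccatiFlow

end
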